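import Mathlib.LinearAlgebra.Matrix.Adjugate
import Literature.NumberTheory.Transcendental.SemialgebraicMapsProofs
import HarnessLib

/-!
# SoloInformed — first-order logic of `k`-semialgebraic families over a finite parameter index

Solo programme `solo-KontsevichZagierPeriods-informed`, session s138, file 1 of the kernel form of
COROLLARY SQ ("tame Tarski circle squaring is impossible", VERDICT §4 / `real-parameters.md`) for
EQUI-AFFINE dissections.  This file is bookkeeping only — the Boolean / quantifier closure of
`IsSemialgebraic k` phrased for predicates, over an arbitrary finite index type, plus the polynomial
formula for the inverse of an affine map of determinant `±1`:

* `soloInformed_isSemialgebraic_image_comp_of_finite` — coordinate images `w ↦ w ∘ θ` for finite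
  index types (Tarski–Seidenberg, transported from the tree's `Fin`-indexed
  `IsSemialgebraic.image_comp`; the tree's finite-index version lives in a module this seat cannot
  import, so it is re-derived here);
* `soloInformed_setOf_forall_sumElim_mem`, `soloInformed_isSemialgebraic_setOf_forall_fibre` —
  **universal quantification over the fibre coordinates**:
  `{p | ∀ z, (p, z) ∈ T} = (π_params(Tᶜ))ᶜ` is `k`-semialgebraic when `T` is;
* `soloInformed_isSemialgebraic_setOf_and/imp/iff/not/const/forall/exists` — propositional and
  finite-index quantifier closure for `{w | P w}`;
* `soloInformedAffInv M b y = det M • adj M (y - b)` — a POLYNOMIAL formula in `(M, b, y)` which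
  is the two-sided inverse of `x ↦ M x + b` as soon as `(det M)² = 1`
  (`soloInformedAffInv_mulVec_add`, `soloInformed_mulVec_affInv_add`), and commutes with ring
  homomorphisms (`soloInformed_map_affInv`), so that "the inverse image of a piece" stays a
  polynomial condition in the real parameters.

References: Bochnak–Coste–Roy (1998) §2.2 (Tarski–Seidenberg), Prop. 2.2.4; Basu–Pollack–Roy
(2006) §2.5.
-/

noncomputable section

namespace Summit.KontsevichZagierPeriods.KontsevichZagierPeriods.Theorems

open Set MvPolynomial Literature.ModelTheory.ExponentialFields Literature.NumberTheory.Transcendental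

section Logic

variable {k : Type*} [CommRing k] [Algebra k ℝ]

/-- **Coordinate images, finite index types.** For finite `ι`, `κ` and any `θ : κ → ι`, the image
of a `k`-semialgebraic `W ⊆ ℝ^ι` under `w ↦ w ∘ θ` is `k`-semialgebraic (transport of the tree's
`IsSemialgebraic.image_comp` along enumerations). [cite: BochnakCosteRoy1998, Prop. 2.2.1] -/
theorem soloInformed_isSemialgebraic_image_comp_of_finite {ι κ : Type*} [Finite ι] [Finite κ]
    (θ : κ → ι) {W : Set (ι → ℝ)} (hW : IsSemialgebraic k W) :
    IsSemialgebraic k ((fun w : ι → ℝ => w ∘ θ) '' W) := by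
  obtain ⟨q, ⟨eι⟩⟩ := Finite.exists_equiv_fin ι
  obtain ⟨p, ⟨eκ⟩⟩ := Finite.exists_equiv_fin κ
  have h1 : IsSemialgebraic k ((fun u : Fin q → ℝ => u ∘ eι) ⁻¹' W) := hW.preimage_comp eι
  have h2 := (h1.image_comp (eι ∘ θ ∘ eκ.symm)).preimage_comp (ι := κ) eκ.symm
  convert h2 using 1
  ext v
  simp only [mem_image, mem_preimage]
  constructor
  · rintro ⟨w, hw, rfl⟩
    refine ⟨w ∘ eι.symm, ?_, ?_⟩
    · simpa [Function.comp_assoc] using hw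
    · funext x
      simp
  · rintro ⟨u, hu, huv⟩
    refine ⟨u ∘ eι, hu, ?_⟩
    funext x
    simpa using congr_fun huv (eκ x)

/-- **Universal quantification over the fibre is a double complement of a projection**:
`{p | ∀ z, (p,z) ∈ T} = (proj (Tᶜ))ᶜ`. [folklore] -/
theorem soloInformed_setOf_forall_sumElim_mem {α β : Type*} (T : Set (α ⊕ β → ℝ)) :
    {p : α → ℝ | ∀ z : β → ℝ, Sum.elim p z ∈ T} =
      ((fun w : α ⊕ β → ℝ => w ∘ Sum.inl) '' Tᶜ)ᶜ := by
  ext p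
  constructor
  · intro h hp
    obtain ⟨w, hw, hwp⟩ := hp
    apply hw
    have hw' : Sum.elim p (w ∘ Sum.inr) = w := by
      rw [← hwp]
      exact Sum.elim_comp_inl_inr w
    rw [← hw']
    exact h _
  · intro h z
    by_contra hz
    exact h ⟨Sum.elim p z, hz, Sum.elim_comp_inl p z⟩

/-- **`∀` over the fibre preserves `k`-semialgebraicity** (finite parameter index `K`): if
`Φ p z ↔ (p, z) ∈ T` with `T` `k`-semialgebraic, then `{p | ∀ z, Φ p z}` is `k`-semialgebraic
(Tarski–Seidenberg for the projection, and complements). [cite: BochnakCosteRoy1998, Prop. 2.2.4] -/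
theorem soloInformed_isSemialgebraic_setOf_forall_fibre {K : Type*} [Finite K] {n : ℕ}
    {T : Set (K ⊕ Fin n → ℝ)} (hT : IsSemialgebraic k T) {Φ : (K → ℝ) → (Fin n → ℝ) → Prop}
    (h : ∀ p z, Φ p z ↔ Sum.elim p z ∈ T) :
    IsSemialgebraic k {p : K → ℝ | ∀ z, Φ p z} := by
  have hset : {p : K → ℝ | ∀ z, Φ p z} = {p | ∀ z : Fin n → ℝ, Sum.elim p z ∈ T} := by
    ext p
    simp only [mem_setOf_eq, h]
  rw [hset, soloInformed_setOf_forall_sumElim_mem]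
  exact (soloInformed_isSemialgebraic_image_comp_of_finite Sum.inl hT.compl).compl

variable {ι : Type*}

/-- Conjunction of `k`-semialgebraic conditions. [folklore] -/
theorem soloInformed_isSemialgebraic_setOf_and {P Q : (ι → ℝ) → Prop}
    (hP : IsSemialgebraic k {w | P w}) (hQ : IsSemialgebraic k {w | Q w}) :
    IsSemialgebraic k {w : ι → ℝ | P w ∧ Q w} := by
  rw [setOf_and]
  exact hP.inter hQ

/-- Negation of a `k`-semialgebraic condition. [folklore] -/
theorem soloInformed_isSemialgebraic_setOf_not {P : (ι → ℝ) → Prop}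
    (hP : IsSemialgebraic k {w | P w}) : IsSemialgebraic k {w : ι → ℝ | ¬ P w} := by
  rw [← compl_setOf]
  exact hP.compl

/-- Implication between `k`-semialgebraic conditions. [folklore] -/
theorem soloInformed_isSemialgebraic_setOf_imp {P Q : (ι → ℝ) → Prop}
    (hP : IsSemialgebraic k {w | P w}) (hQ : IsSemialgebraic k {w | Q w}) :
    IsSemialgebraic k {w : ι → ℝ | P w → Q w} := by
  have hset : {w : ι → ℝ | P w → Q w} = {w | ¬ P w} ∪ {w | Q w} := by
    ext w
    simp only [mem_setOf_eq, mem_union]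
    exact imp_iff_not_or
  rw [hset]
  exact (soloInformed_isSemialgebraic_setOf_not hP).union hQ

/-- Equivalence between `k`-semialgebraic conditions. [folklore] -/
theorem soloInformed_isSemialgebraic_setOf_iff {P Q : (ι → ℝ) → Prop}
    (hP : IsSemialgebraic k {w | P w}) (hQ : IsSemialgebraic k {w | Q w}) :
    IsSemialgebraic k {w : ι → ℝ | P w ↔ Q w} := by
  have hset : {w : ι → ℝ | P w ↔ Q w} = {w | (P w → Q w) ∧ (Q w → P w)} := by
    ext w
    simp only [mem_setOf_eq]
    exact iff_iff_implies_and_implies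
  rw [hset]
  exact soloInformed_isSemialgebraic_setOf_and (soloInformed_isSemialgebraic_setOf_imp hP hQ)
    (soloInformed_isSemialgebraic_setOf_imp hQ hP)

/-- A condition not depending on the point is `k`-semialgebraic (`univ` or `∅`). [folklore] -/
theorem soloInformed_isSemialgebraic_setOf_const (c : Prop) :
    IsSemialgebraic k {_w : ι → ℝ | c} := by
  by_cases hc : c
  · simp only [hc, setOf_true]
    exact isSemialgebraic_univ
  · simp only [hc, setOf_false]
    exact isSemialgebraic_empty

/-- Universal quantification over a FINITE index preserves `k`-semialgebraicity. [folklore] -/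
theorem soloInformed_isSemialgebraic_setOf_forall {α : Type*} [Fintype α] {P : α → (ι → ℝ) → Prop}
    (hP : ∀ a, IsSemialgebraic k {w | P a w}) : IsSemialgebraic k {w : ι → ℝ | ∀ a, P a w} := by
  have hset : {w : ι → ℝ | ∀ a, P a w} = ⋂ a ∈ (Finset.univ : Finset α), {w | P a w} := by
    ext w
    simp only [mem_setOf_eq, Finset.mem_univ, mem_iInter, iInter_true]
  rw [hset]
  exact IsSemialgebraic.biInter _ _ fun a _ => hP a

/-- Existential quantification over a FINITE index preserves `k`-semialgebraicity. [folklore] -/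
theorem soloInformed_isSemialgebraic_setOf_exists {α : Type*} [Fintype α] {P : α → (ι → ℝ) → Prop}
    (hP : ∀ a, IsSemialgebraic k {w | P a w}) : IsSemialgebraic k {w : ι → ℝ | ∃ a, P a w} := by
  have hset : {w : ι → ℝ | ∃ a, P a w} = ⋃ a ∈ (Finset.univ : Finset α), {w | P a w} := by
    ext w
    simp only [mem_setOf_eq, Finset.mem_univ, mem_iUnion, iUnion_true]
  rw [hset]
  exact IsSemialgebraic.biUnion _ _ fun a _ => hP a

/-- Renamed parameter polynomials evaluate on a joint point through the parameter block.
[folklore] -/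
theorem soloInformed_aeval_rename_inl {α β : Type*} (w : α ⊕ β → ℝ) (q : MvPolynomial α k) :
    aeval w (rename Sum.inl q) = aeval (w ∘ Sum.inl) q := by
  rw [aeval_rename]

end Logic

section AffineInverse

variable {R : Type*} [CommRing R] {n : ℕ}

/-- **The polynomial inverse of an equi-affine map**: `y ↦ det M • adj M (y - b)`, a polynomial
expression in the entries of `M`, `b`, `y` over any commutative ring. [folklore] -/
def soloInformedAffInv (M : Matrix (Fin n) (Fin n) R) (b y : Fin n → R) : Fin n → R :=
  M.det • (M.adjugate.mulVec (y - b))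

/-- `det M • adj M (M x + b - b) = (det M)² x = x` when `(det M)² = 1`. [folklore] -/
theorem soloInformedAffInv_mulVec_add (M : Matrix (Fin n) (Fin n) R) (hM : M.det ^ 2 = 1)
    (b x : Fin n → R) : soloInformedAffInv M b (M.mulVec x + b) = x := by
  simp only [soloInformedAffInv, add_sub_cancel_right, Matrix.mulVec_mulVec, Matrix.adjugate_mul,
    Matrix.smul_mulVec, Matrix.one_mulVec, smul_smul, ← sq, hM, one_smul]

/-- `M (det M • adj M (y - b)) + b = (det M)² (y - b) + b = y` when `(det M)² = 1`. [folklore] -/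
theorem soloInformed_mulVec_affInv_add (M : Matrix (Fin n) (Fin n) R) (hM : M.det ^ 2 = 1)
    (b y : Fin n → R) : M.mulVec (soloInformedAffInv M b y) + b = y := by
  simp only [soloInformedAffInv, Matrix.mulVec_smul, Matrix.mulVec_mulVec, Matrix.mul_adjugate,
    Matrix.smul_mulVec, Matrix.one_mulVec, smul_smul, ← sq, hM, one_smul, sub_add_cancel]

/-- The inverse formula commutes with ring homomorphisms (it is polynomial). [folklore] -/
theorem soloInformed_map_affInv {S : Type*} [CommRing S] (f : R →+* S)
    (M : Matrix (Fin n) (Fin n) R) (b y : Fin n → R) :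
    ⇑f ∘ soloInformedAffInv M b y = soloInformedAffInv (M.map ⇑f) (⇑f ∘ b) (⇑f ∘ y) := by
  have hadj : M.adjugate.map ⇑f = (M.map ⇑f).adjugate := by
    simpa only [RingHom.mapMatrix_apply] using RingHom.map_adjugate f M
  have hsub : (⇑f ∘ (y - b)) = ⇑f ∘ y - ⇑f ∘ b := by
    funext t
    simp only [Function.comp_apply, Pi.sub_apply, map_sub]
  funext s
  simp only [soloInformedAffInv, Function.comp_apply, Pi.smul_apply, smul_eq_mul, map_mul,
    RingHom.map_det, RingHom.mapMatrix_apply, RingHom.map_mulVec, hadj, hsub]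

end AffineInverse

end Summit.KontsevichZagierPeriods.KontsevichZagierPeriods.Theorems
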